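import Literature.NumberTheory.ComplexMultiplication.SexticCMTypesB3IndexSix
import Literature.NumberTheory.ComplexMultiplication.CMTypeRankFixedVectorCriteria
import Literature.AlgebraicGeometry.Pohlmann1968.CMFamilyRankPartitionSlots
import Summits.HodgeConjecture.CorCM.GenericSexticThreefoldTimesCMHodge
import HarnessLib

/-!
# Two NON-ISOMORPHIC sextic CM fields with pair flips inside ONE Galois closure (twin fields `F(√−α)`, `F(√−α·disc F)`):
# the character modules of their Hodge groups share no simple factor

COR-CM (cell `pub-hodgecm2`, binder seat `b16` gen 43, count-neutral claim CM-DIMLE3-PRODUCTS, file D3b; theorems only, no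
definition, no named fact, no `sorry`).  NEW as stated, hence under `Summits/`.  The pair criteria of the tree separate two
slots by a partial conjugation (closures meeting in a real field), by dimension/irreducibility, by an element fixing one
closure and moving the other (`pairwise_of_irreducible_of_not_normalClosure_le`), or by an eigenline.  None applies to two
pair-flip sextic CM fields `K_i ≇ K_j` with the SAME Galois closure `L` of degree `48` — the twins `K = F(√−α)` and
`K^{tw} = F(√(−α·disc F))` (`F = K⁺` a non-Galois totally real cubic), whose modules `U(Φ)` are the two faithful
`3`-dimensional odd representations `r` and `r ⊗ sgn` of `Gal(L/ℚ) ≅ C₂ × 𝔖₄`.  Here they are separated by criterion (δ)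
(`pairwise_of_irreducible_of_fixed`): for an embedding `y` of `K_j`, the stabiliser `Aut(ℂ/y(K_j))` fixes the odd vector
`δ_y − δ_ȳ ∈ U(Φ_j)` but NO non-zero odd weight on `Hom(K_i, ℂ)`, because it maps EVERY embedding `x` of `K_i` to `x̄`
(`exists_mem_stabilizer_smul_eq_conj`) — the field form of `SexticB3.fixes_or_conjugates` (an index-six subgroup of the
Galois image fixes a point, which would force `x(K_i) = y(K_j)`, or conjugates every point).

* `exists_mem_stabilizer_smul_eq_conj` — `K_i` sextic CM with pair flips, `K_j` sextic CM with `L_j ≤ L_i`, `K_i ≇ K_j`: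
  for all `x : K_i → ℂ`, `y : K_j → ℂ` some `τ ∈ Aut(ℂ)` fixes `y` and maps `x` to `x̄`;
* **`pairwise_pairFlip_of_normalClosure_le_of_isEmpty`** — both fields with pair flips, `L_j ≤ L_i`, `K_i ≇ K_j`: `U(Φ_i)`,
  `U(Φ_j)` have no common constituent, in both orders (so in a Galois-closure class of pair-flip type the isomorphism
  classes of fields are mutually independent: with seat p2's «at most three per field» this bounds nothing else).

HC_CM is NOT touched.

## References

* [Dodson1984] B. Dodson, *The structure of Galois groups of CM-fields*, Trans. AMS 283 (1984), §1.1, §5.1.2.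
* [Gordon1999HodgeAVSurvey] B. B. Gordon, *A survey of the Hodge conjecture for abelian varieties*, §3 Theorem, 7.5–7.7.
* [Lang2002] S. Lang, *Algebra*, GTM 211, VI §1 Thm. 1.1, Cor. 1.6 (Galois correspondence).
* [Serre1977] J.-P. Serre, *Linear Representations of Finite Groups*, GTM 42, §2.2.
-/

noncomputable section

open NumberField Module IntermediateField Equiv

namespace Summit.HodgeConjecture.CorCM

open Literature.NumberTheory.ComplexMultiplication
open Literature.NumberTheory.ComplexMultiplication.SexticB3
open Literature.AlgebraicGeometry.Motives (CMType)
open Literature.AlgebraicGeometry.Pohlmann1968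

variable {I : Type} {K : I → Type} [∀ i, Field (K i)] [∀ i, NumberField (K i)] [∀ i, IsCMField (K i)]

/-! ## §1 The stabiliser of an embedding of `K_j` conjugates every embedding of `K_i` -/

section Stabiliser

/-- The image of an embedding of a number field is finite over `ℚ`. [folklore] -/
private theorem finiteDimensional_fieldRange₄₇ {F : Type} [Field F] [NumberField F] (f : F →ₐ[ℚ] ℂ) :
    FiniteDimensional ℚ f.fieldRange :=
  LinearEquiv.finiteDimensional (AlgEquiv.ofInjectiveField f).toLinearEquiv

omit [∀ i, IsCMField (K i)] in
/-- If the stabiliser of `y : K_j → ℂ` in `Aut(ℂ)` fixes `x : K_i → ℂ`, then `x(K_i) ⊆ y(K_j)` (Galois correspondence for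
`Aut(ℂ)`: an element outside `y(K_j)` is moved by an automorphism fixing `y(K_j)`). [cite: Lang2002, VI §1 Thm. 1.1 and Cor. 1.6] -/
theorem fieldRange_le_of_stabilizer_le {i j : I} {x : K i →+* ℂ} {y : K j →+* ℂ}
    (h : ∀ τ : ℂ ≃+* ℂ, τ • y = y → τ • x = x) : x.toRatAlgHom.fieldRange ≤ y.toRatAlgHom.fieldRange := by
  intro z hz
  by_contra hzy
  haveI := finiteDimensional_fieldRange₄₇ x.toRatAlgHom
  haveI := finiteDimensional_fieldRange₄₇ y.toRatAlgHom
  obtain ⟨τ, hτy, hτz⟩ := exists_ringEquiv_apply_ne_of_not_mem hz hzy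
  have hτy' : τ • y = y := RingHom.ext fun a => by
    rw [ringEquiv_smul_apply]; exact hτy _ (AlgHom.mem_fieldRange.2 ⟨a, rfl⟩)
  obtain ⟨a, rfl⟩ := AlgHom.mem_fieldRange.1 hz
  apply hτz
  have := RingHom.congr_fun (h τ hτy') a
  rw [ringEquiv_smul_apply] at this
  exact this

omit [∀ i, IsCMField (K i)] in
/-- Equal images give an isomorphism of fields. [folklore] -/
private theorem nonempty_ringEquiv_of_fieldRange_eq {i j : I} {x : K i →+* ℂ} {y : K j →+* ℂ}
    (h : x.toRatAlgHom.fieldRange = y.toRatAlgHom.fieldRange) : Nonempty (K i ≃+* K j) :=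
  ⟨((AlgEquiv.ofInjectiveField x.toRatAlgHom).trans
    ((IntermediateField.equivOfEq h).trans (AlgEquiv.ofInjectiveField y.toRatAlgHom).symm)).toRingEquiv⟩

/-- **The stabiliser of `y` maps every `x` to `x̄`.**  Let `K_i` be a sextic CM field with pair flips, `K_j` a sextic CM
field whose Galois closure lies in that of `K_i`, and `K_i ≇ K_j`.  Then for all embeddings `x : K_i → ℂ`, `y : K_j → ℂ`
some `τ ∈ Aut(ℂ)` satisfies `τ ∘ y = y` and `τ ∘ x = x̄`.  (The image `H` of `Stab(y)` in the Galois image `𝒢 ≤ W(B₃)` on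
`Hom(K_i, ℂ)` has index six and misses `cc`; by `SexticB3.fixes_or_conjugates` it fixes a point — then `x₀(K_i) ⊆ y(K_j)`,
`K_i ≅ K_j` — or conjugates every point.) [cite: Dodson1984, §5.1.2 Theorem] [cite: Lang2002, VI §1 Cor. 1.6] -/
theorem exists_mem_stabilizer_smul_eq_conj {i j : I} (h6i : finrank ℚ (K i) = 6) (h6j : finrank ℚ (K j) = 6)
    (hflip : ∀ s : K i →+* ℂ, ∃ σ : ℂ ≃+* ℂ, σ • s = (starRingAut : ℂ ≃+* ℂ) • s ∧
      ∀ t : K i →+* ℂ, t ≠ s → t ≠ (starRingAut : ℂ ≃+* ℂ) • s → σ • t = t)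
    (hle : normalClosure ℚ (K j) ℂ ≤ normalClosure ℚ (K i) ℂ) (hne : IsEmpty (K i ≃+* K j))
    (x : K i →+* ℂ) (y : K j →+* ℂ) :
    ∃ τ : ℂ ≃+* ℂ, τ • y = y ∧ τ • x = (starRingAut : ℂ ≃+* ℂ) • x := by
  classical
  set c : ℂ ≃+* ℂ := starRingAut with hc_def
  have hCM : IsCMTypeWith c (CMTypeCount.stdCMType (K := K i)).1 := isCMTypeWith_conj _
  have hX : Fintype.card (K i →+* ℂ) = 6 := by rw [Embeddings.card, h6i]
  -- normal form for complex conjugation on `Hom(K_i, ℂ)`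
  obtain ⟨e, -, hce⟩ := exists_equiv_cc hX (MulAction.toPerm c)
    (fun s => by simpa [MulAction.toPerm_apply] using hCM.invol s)
    (fun s => by simpa [MulAction.toPerm_apply] using hCM.rho_smul_ne s) x
  replace hce : ∀ s, e (c • s) = cc (e s) := fun s => by simpa [MulAction.toPerm_apply] using hce s
  have hce' : ∀ k, e.symm (cc k) = c • e.symm k := fun k =>
    e.injective (by rw [Equiv.apply_symm_apply, hce, Equiv.apply_symm_apply])
  -- the permutation image `f : Aut(ℂ) → W(B₃)` and `𝒢 = f(Aut(ℂ))`
  set f : (ℂ ≃+* ℂ) →* Perm (Fin 6) := toPerm6 e with hf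
  have hfapp : ∀ (g : ℂ ≃+* ℂ) (k : Fin 6), f g k = e (g • e.symm k) := fun g k => toPerm6_apply e g k
  have hfe : ∀ (g : ℂ ≃+* ℂ) (s : K i →+* ℂ), e (g • s) = f g (e s) := fun g s => by
    rw [hfapp, Equiv.symm_apply_apply]
  have hfW : ∀ g : ℂ ≃+* ℂ, f g * cc = cc * f g := fun g => by
    ext k
    rw [Perm.mul_apply, Perm.mul_apply, hfapp, hce', hfapp, ← hce, hCM.comm]
  set 𝒢 : Subgroup (Perm (Fin 6)) := f.range with h𝒢
  have h𝒢W : 𝒢 ≤ W := by rintro _ ⟨g, rfl⟩; exact mem_W.2 (hfW g)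
  have hcc𝒢 : cc ∈ 𝒢 := ⟨c, toPerm6_eq_cc hce⟩
  -- the sign changes lie in `𝒢` (pair flips)
  have hswap : ∀ k : Fin 6, swap k (cc k) ∈ 𝒢 := by
    intro k
    obtain ⟨σ, hσ1, hσ2⟩ := hflip (e.symm k)
    refine ⟨σ, Equiv.ext fun m => ?_⟩
    rw [hfapp]
    by_cases hm : m = k
    · subst hm
      rw [hσ1, hce, Equiv.apply_symm_apply, swap_apply_left]
    · by_cases hm' : m = cc k
      · subst hm'
        rw [hce', hCM.comm, hσ1, hCM.invol, Equiv.apply_symm_apply, swap_apply_right]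
      · rw [hσ2 (e.symm m) (fun h => hm (e.symm.injective h))
          (fun h => hm' (e.symm.injective (by rw [hce']; exact h))), Equiv.apply_symm_apply,
          swap_apply_of_ne_of_ne hm hm']
  have hf0 : f0 ∈ 𝒢 := by have := hswap 0; rwa [show cc 0 = 3 by decide] at this
  have hf1 : f1 ∈ 𝒢 := by have := hswap 1; rwa [show cc 1 = 4 by decide] at this
  have hf2 : f2 ∈ 𝒢 := by have := hswap 2; rwa [show cc 2 = 5 by decide] at this
  -- transitivity
  haveI := isPretransitive_ringEquiv_complex (K := K i)
  haveI := isPretransitive_ringEquiv_complex (K := K j)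
  have htrans : ∀ k : Fin 6, ∃ g ∈ 𝒢, g 0 = k := fun k => by
    obtain ⟨g, hg⟩ := MulAction.exists_smul_eq (ℂ ≃+* ℂ) (e.symm 0) (e.symm k)
    exact ⟨f g, ⟨g, rfl⟩, by rw [hfapp, hg, Equiv.apply_symm_apply]⟩
  -- the stabiliser `S` of `y` and its image `H`; `ker f ≤ S`
  set S : Subgroup (ℂ ≃+* ℂ) := MulAction.stabilizer (ℂ ≃+* ℂ) y with hS
  have hker : f.ker ≤ S := by
    intro g hg
    rw [MonoidHom.mem_ker] at hg
    have hfix : ∀ s : K i →+* ℂ, g • s = (1 : ℂ ≃+* ℂ) • s := fun s => by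
      rw [one_smul]
      exact e.injective (by rw [hfe, hg, Perm.one_apply])
    rw [hS, MulAction.mem_stabilizer_iff]
    exact RingHom.ext fun a => by
      rw [ringEquiv_smul_apply]
      exact apply_eq_of_forall_smul_eq i hfix (hle (apply_mem_normalClosure j y a))
  set H : Subgroup (Perm (Fin 6)) := S.map f with hH
  have hHG : H ≤ 𝒢 := Subgroup.map_le_range f S
  -- index six
  have hidx : Nat.card H * 6 = Nat.card 𝒢 := by
    have hSidx : S.index = 6 := by
      rw [hS, MulAction.index_stabilizer_of_transitive, Nat.card_eq_fintype_card, Embeddings.card, h6j]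
    have h1 : H.index = (S ⊔ f.ker).index * 𝒢.index := Subgroup.index_map S f
    rw [sup_eq_left.2 hker, hSidx] at h1
    have h2 := H.card_mul_index
    have h3 := 𝒢.card_mul_index
    have hpos : 0 < 𝒢.index := Nat.pos_of_ne_zero Subgroup.index_ne_zero_of_finite
    rw [h1] at h2
    have : Nat.card H * 6 * 𝒢.index = Nat.card 𝒢 * 𝒢.index := by rw [mul_assoc, h2, h3]
    exact Nat.eq_of_mul_eq_mul_right hpos this
  -- the dichotomy
  rcases fixes_or_conjugates 𝒢 H h𝒢W hHG hf0 hf1 hf2 hcc𝒢 htrans hidx with ⟨k₀, hk₀⟩ | hall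
  · -- `S` fixes `x₀ = e⁻¹ k₀`: then `x₀(K_i) = y(K_j)`, contradicting `K_i ≇ K_j`
    exfalso
    set x₀ : K i →+* ℂ := e.symm k₀ with hx₀
    have hfixx : ∀ τ : ℂ ≃+* ℂ, τ • y = y → τ • x₀ = x₀ := fun τ hτ => by
      have hτS : τ ∈ S := by rw [hS]; exact MulAction.mem_stabilizer_iff.2 hτ
      have hτH : f τ ∈ H := ⟨τ, hτS, rfl⟩
      have := hk₀ (f τ) hτH
      rw [hfapp] at this
      exact e.injective (by rw [this, hx₀, Equiv.apply_symm_apply])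
    have hle' := fieldRange_le_of_stabilizer_le hfixx
    haveI := finiteDimensional_fieldRange₄₇ x₀.toRatAlgHom
    haveI := finiteDimensional_fieldRange₄₇ y.toRatAlgHom
    have hxr : finrank ℚ ↥x₀.toRatAlgHom.fieldRange = 6 :=
      ((AlgEquiv.ofInjectiveField x₀.toRatAlgHom).toLinearEquiv.finrank_eq).symm.trans h6i
    have hyr : finrank ℚ ↥y.toRatAlgHom.fieldRange = 6 :=
      ((AlgEquiv.ofInjectiveField y.toRatAlgHom).toLinearEquiv.finrank_eq).symm.trans h6j
    have heq := IntermediateField.eq_of_le_of_finrank_eq hle' (hxr.trans hyr.symm)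
    exact hne.false (Classical.choice (nonempty_ringEquiv_of_fieldRange_eq heq))
  · obtain ⟨h, ⟨τ, hτS, rfl⟩, hτx⟩ := hall (e x)
    have hτS' : τ ∈ S := hτS
    rw [hS] at hτS'
    refine ⟨τ, MulAction.mem_stabilizer_iff.1 hτS', e.injective ?_⟩
    rw [hfe, hτx, hce]

end Stabiliser

/-! ## §2 No common constituent for twin pair-flip sextic fields -/

section Pairwise

/-- **Twin pair-flip sextic fields share no constituent.**  For two slots carrying sextic CM fields WITH pair flips,
`L_j ≤ L_i` (e.g. the same Galois closure) and `K_i ≇ K_j`: the `Aut(ℂ)`-modules `U(Φ_i)`, `U(Φ_j)` have no common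
constituent, in both orders — criterion (δ) with `S = Aut(ℂ/y(K_j))`, which fixes `δ_y − δ_ȳ ∈ U(Φ_j) = Anti`
(irreducible) and no non-zero odd weight on `Hom(K_i, ℂ)`. [cite: Dodson1984, §5.1.2 Theorem] [cite: Serre1977, §2.2]
[cite: Gordon1999HodgeAVSurvey, §3 Theorem (proof)] -/
theorem pairwise_pairFlip_of_normalClosure_le_of_isEmpty {Φ : ∀ i, CMType (K i)} {i j : I}
    (h6i : finrank ℚ (K i) = 6) (h6j : finrank ℚ (K j) = 6)
    (hflipi : ∀ s : K i →+* ℂ, ∃ σ : ℂ ≃+* ℂ, σ • s = (starRingAut : ℂ ≃+* ℂ) • s ∧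
      ∀ t : K i →+* ℂ, t ≠ s → t ≠ (starRingAut : ℂ ≃+* ℂ) • s → σ • t = t)
    (hflipj : ∀ s : K j →+* ℂ, ∃ σ : ℂ ≃+* ℂ, σ • s = (starRingAut : ℂ ≃+* ℂ) • s ∧
      ∀ t : K j →+* ℂ, t ≠ s → t ≠ (starRingAut : ℂ ≃+* ℂ) • s → σ • t = t)
    (hle : normalClosure ℚ (K j) ℂ ≤ normalClosure ℚ (K i) ℂ) (hne : IsEmpty (K i ≃+* K j)) :
    (∀ P : Submodule ℚ ((K i →+* ℂ) → ℚ), P ≤ antiSpan (ℂ ≃+* ℂ) (Φ i).1 →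
      (∀ g : ℂ ≃+* ℂ, ∀ f ∈ P, (fun x => f (g • x)) ∈ P) →
      ∀ T : ((K i →+* ℂ) → ℚ) →ₗ[ℚ] ((K j →+* ℂ) → ℚ),
        (∀ g : ℂ ≃+* ℂ, ∀ f ∈ P, T (fun x => f (g • x)) = fun y => T f (g • y)) →
        (∀ f ∈ P, T f ∈ antiSpan (ℂ ≃+* ℂ) (Φ j).1) → (∀ f ∈ P, T f = 0 → f = 0) → P = ⊥) ∧
    (∀ P : Submodule ℚ ((K j →+* ℂ) → ℚ), P ≤ antiSpan (ℂ ≃+* ℂ) (Φ j).1 →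
      (∀ g : ℂ ≃+* ℂ, ∀ f ∈ P, (fun x => f (g • x)) ∈ P) →
      ∀ T : ((K j →+* ℂ) → ℚ) →ₗ[ℚ] ((K i →+* ℂ) → ℚ),
        (∀ g : ℂ ≃+* ℂ, ∀ f ∈ P, T (fun x => f (g • x)) = fun y => T f (g • y)) →
        (∀ f ∈ P, T f ∈ antiSpan (ℂ ≃+* ℂ) (Φ i).1) → (∀ f ∈ P, T f = 0 → f = 0) → P = ⊥) := by
  classical
  obtain ⟨y⟩ : Nonempty (K j →+* ℂ) := inferInstance
  set ρ : ℂ ≃+* ℂ := starRingAut with hρ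
  obtain ⟨hirrj, -, hndj⟩ := irreducible_and_finrank_eq_of_pairFlip (Φ := Φ) hflipj
  have hUj : antiSpan (ℂ ≃+* ℂ) (Φ j).1 = antiWeights (E := K j →+* ℂ) ρ := by
    refine (isCMTypeWith_conj (Φ j)).typeRank_eq_iff_antiSpan_eq.1 ?_
    rw [Embeddings.card]; exact hndj
  -- criterion (δ), irreducible side `j`, with `S = Stab(y)`
  have h := pairwise_of_irreducible_of_fixed (G := ℂ ≃+* ℂ) (Φ := fun i => (Φ i).1) (i := j) (j := i)
    {τ : ℂ ≃+* ℂ | τ • y = y} hirrj ?_ ?_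
  · exact ⟨h.2, h.1⟩
  · -- `δ_y − δ_ȳ` is a non-zero `S`-fixed vector of `U(Φ_j)`
    refine ⟨Pi.single y (1 : ℚ) - Pi.single (ρ • y) 1, ?_, ?_, fun τ hτ => ?_⟩
    · rw [hUj]; exact single_sub_single_mem_antiWeights (isCMTypeWith_conj (Φ j)).invol y
    · intro h0
      have := congrFun h0 y
      simp only [Pi.sub_apply, Pi.single_apply, Pi.zero_apply] at this
      rw [if_neg ((isCMTypeWith_conj (Φ j)).rho_smul_ne y).symm] at this
      norm_num at this
    · have hτ' : τ • y = y := hτ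
      have hinv : τ⁻¹ • y = y := by
        conv_lhs => rw [← hτ']
        rw [inv_smul_smul]
      rw [single_sub_single_comp_smul (isCMTypeWith_conj (Φ j)).comm y τ, hinv]
  · -- no non-zero `S`-fixed vector in `U(Φ_i)`: every `x` is conjugated by `S`
    intro f hf hfS
    funext x
    obtain ⟨τ, hτy, hτx⟩ := exists_mem_stabilizer_smul_eq_conj h6i h6j hflipi hle hne x y
    have h1 := congrFun (hfS τ hτy) x
    rw [hτx] at h1
    have h2 : f (ρ • x) = -f x := apply_rho_smul_of_mem_antiSpan (isCMTypeWith_conj (Φ i)) hf x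
    rw [h2] at h1
    simp only [Pi.zero_apply]
    linarith

end Pairwise

end Summit.HodgeConjecture.CorCM

end
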